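import Summits.AtomisticToContinuum.HydrodynamicLimit.Theorems.OneFlightGossipEngineEnergyCurrentTailsFirstPartnerObjects
import Summits.AtomisticToContinuum.HydrodynamicLimit.Theorems.OneFlightGossipEngineEnergyCurrentTailsFirstPartnerRung0
import Summits.AtomisticToContinuum.HydrodynamicLimit.Theorems.OneFlightGossipEngineEnergyCurrentTailsLevelCensusPreCollisionFlux
import Literature.MathematicalPhysics.KineticTheory.CollisionFluxMeanBoundNonStationary
import Literature.MathematicalPhysics.KineticTheory.ShortFlightCount
import HarnessLib

/-!
# Seat c8 (lead), crux `EnergyCurrentTails` (stmt-AtomisticToContinuum-9235), line `quartic-schur-ledger`: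
# the RUNG-0 certificate of the registered primitive I′ `stub_firstPartnerDisturbanceCeiling`
# (`FirstPartnerRealisedShare`, child item stmt-AtomisticToContinuum-18199) — helper stub STATEMENTS
# (registered by `stub-add`; proved by the wave; sorries only here).

Rung 0 = constant profiles `(a, u, θ)`: the homogeneous drifted Gibbs law `G_N` is invariant under every hard-sphere
flow.  I′ says `E[firstPartnerSum] ≤ A · E[realisedFirstSum]` for every look-ahead `0 < Δ ≤ τ₀ h_N`: in the mark-weighted
mean at least the fraction `1/A` of the FIRST free-flight encounters predicted at time `r` happen undisturbed.  The
certificate is `A = 2`, `τ₀ = τ₀(K₀, K₁, σ, u, θ)`: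

* S1 `shareRung0_charging` (sure kinematics, any flow on `𝕋³`): the disturbed part `firstPartnerSum − realisedFirstSum`
  is charged to the FIRST disturbing collision `(s, e, k)`, `s ∈ (r, r + Δ]`: in the PRE-collisional configuration
  `collidePair e k (Φ_s z)` the disturbed pair is a would-be pair `(e, o)` or `(o, e)`, `o ∉ {e, k}`, with the same mark
  (both endpoints flew freely on `[r, s]`; the disturbing collision is binary and is not the pair's own contact, which
  comes later) — a collision sum of the FORWARD-CONE CHARGE
  `pairSum ε Δ y 0 F {p ∈ wouldBePairs ε Δ y : (p.1 = e ∧ p.2 ≠ k) ∨ (p.2 = e ∧ p.1 ≠ k)}`;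
* S2 `shareRung0_forwardEngine` (the PRE-collisional one-window flux engine for CONFIGURATION marks, with an exported
  measurable majorant; forward twin of `exists_measurable_majorant_collisionSum`, general-mark twin of
  `EnergyCurrentTailsLevelCensus.sum_collision_pre_le_sum_window`): each collision of `(s, s + τ]` is preceded by free
  flight from the previous grid time, whose configuration reaches contact after a FORWARD flight `≤ τ/M`;
* S3 `shareRung0_flightTransfer` (sure): would-be pairs of a forward free flight of duration `t` are would-be pairs of
  look-ahead `Δ + t`; marks bounded by a velocity weight;
* S4 `shareRung0_statics` (3-label Ruelle statics, weighted, two look-aheads): forward contact of `(e, k)` within `h₁`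
  AND `(e, o)` would-be within `h₂`, weight `(‖v_e‖² + ‖v_o‖²)²`: measurable majorants of Gibbs mean
  `≤ C (N+1)³ ε⁴ h₁ h₂` (`C = C(σ, u, θ)`; twin of `firstPartnerRung0_excess` / `measure_windowEvent_inter_tubeEvent_le`);
* S5 `shareRung0_markPositive`: positivity of the Maxwellian mean of the sphere-integrated band mixing mark for GENERAL
  thresholds `K₀`, `K₁ > 0` (band `K₂ = 3|K₀| + 3`; scaling of `firstPartnerRung0_markPositive`);
* S6 `shareRung0_floorWindow`: the static first-partner floor up to the out-degree-≥-2 excess, for GENERAL thresholds and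
  an explicit look-ahead `Δ = κ ε` (public general-`K` twin of the private `rung0_floor_window` of
  `…FirstPartnerRung0`, from H1 `firstPartnerRung0_pathwise`, H2 `firstPartnerRung0_excess`, H3
  `sum_pair_tubeMark_mean_ge_of_measurable`);
* target `stub_firstPartnerRealisedShareRung0` = I′ `FirstPartnerRealisedShare` at constant profiles (lead).

Scaling (why it closes): with `p_Δ = σ²(N+1)^{1/3}Δ`, the disturbed mean is `≤ C p_Δ² · (marks)` (S1–S4: flux × tube,
three labels) while the first-partner mean is `≥ c p_Δ Θ̄ − C′ p_Δ²` (S5–S6); `p_Δ ≤ σ² τ₀` makes the disturbed share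
`≤ 1/2` uniformly in `N ≥ N₀` and `Δ ≤ τ₀ h_N`.
-/

noncomputable section

open scoped BigOperators Classical ENNReal InnerProductSpace
open MeasureTheory Set Filter
open Literature.Analysis.FluidPDE Literature.MathematicalPhysics.KineticTheory
  Literature.MathematicalPhysics.StatisticalMechanics

namespace Summit.AtomisticToContinuum.HydrodynamicLimit.Theorems

namespace QuarticSchurLedger

open EnergyCurrentTailsFirstPartner RateFloorLine

/-- **S1 · sure charging of the disturbed first-partner marks to the first disturbing collision.** -/
theorem shareRung0_charging : ∀ (σ : ℝ), 0 < σ → σ < 1 / 2 → ∀ (N : ℕ) (Φ : HardSphereFlow (Torus.geometry (Fin 3)) (hsDiameter σ N) (N + 1)) (z : Config (N + 1) (Fin 3) T3), z ∈ Φ.good → ∀ (F₀ : T3 → T3 → V3 → V3 → ℝ), (∀ x y v w, 0 ≤ F₀ x y v w) → ∀ (r Δ : ℝ), 0 < Δ → ENNReal.ofReal (firstPartnerSum (hsDiameter σ N) Δ (Φ.flow r z) r (fun _ => F₀)) ≤ ENNReal.ofReal (realisedFirstSum (hsDiameter σ N) Δ (fun t => Φ.flow t z) r (fun _ => F₀))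 + ∑ᶠ s ∈ collisionTimes (Torus.geometry (Fin 3)) (hsDiameter σ N) (fun t => Φ.flow t z) ∩ Set.Ioc r (r + Δ), ∑ e : Fin (N + 1), ∑ k : Fin (N + 1), (if e ≠ k ∧ ‖(Torus.geometry (Fin 3)).sepVec (Φ.flow s z e).1 (Φ.flow s z k).1‖ = hsDiameter σ N then ENNReal.ofReal (pairSum (hsDiameter σ N) Δ (collidePair (Torus.geometry (Fin 3)) e k (Φ.flow s z)) 0 (fun _ => F₀) ((wouldBePairs (hsDiameter σ N) Δ (collidePair (Torus.geometry (Fin 3)) e k (Φ.flow s z))).filter fun p => (p.1 = e ∧ p.2 ≠ k) ∨ (p.2 = e ∧ p.1 ≠ k))) else 0) := by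
  sorry

/-- **S2 · the pre-collisional one-window flux engine for configuration marks (measurable majorant exported).** -/
theorem shareRung0_forwardEngine : ∀ {n : ℕ} {ε : ℝ} (Φ : HardSphereFlow (Torus.geometry (Fin 3)) ε n) {τ : ℝ}, 0 < τ → ∀ (s : ℝ) (F : Config n (Fin 3) T3 → Fin n → Fin n → ℝ≥0∞) (E : ℕ → Fin n → Fin n → Set (Config n (Fin 3) T3)), (∀ M i j, MeasurableSet (E M i j)) → (∀ (M : ℕ) (i j : Fin n), i ≠ j → ∀ w ∈ hardSphereDomain (Torus.geometry (Fin 3)) n ε, ∀ t ∈ Set.Icc 0 (τ / M), ‖(Torus.geometry (Fin 3)).sepVec ((freeFlight (Torus.geometry (Fin 3)) t w i).1) ((freeFlight (Torus.geometry (Fin 3)) t w j).1)‖ = ε → w ∈ E M i j) → ∀ (Ft : ℕ → Config n (Fin 3) T3 → Fin n → Fin n → ℝ≥0∞), (∀ M i j, Measurable fun w => Ft M w i j) → (∀ (M : ℕ) (i j : Fin n), i ≠ j → ∀ w ∈ hardSphereDomain (Torus.geometry (Fin 3)) n ε, ∀ t ∈ Set.Icc 0 (τ / M), ‖(Torus.geometry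 (Fin 3)).sepVec ((freeFlight (Torus.geometry (Fin 3)) t w i).1) ((freeFlight (Torus.geometry (Fin 3)) t w j).1)‖ = ε → F (freeFlight (Torus.geometry (Fin 3)) t w) i j ≤ Ft M w i j) → ∃ g : Config n (Fin 3) T3 → ℝ≥0∞, Measurable g ∧ (∀ z ∈ Φ.good, ∑ᶠ r ∈ collisionTimes (Torus.geometry (Fin 3)) ε (fun t => Φ.flow t z) ∩ Set.Ioc s (s + τ), ∑ i : Fin n, ∑ j : Fin n, (if i ≠ j ∧ ‖(Torus.geometry (Fin 3)).sepVec (Φ.flow r z i).1 (Φ.flow r z j).1‖ = ε then F (collidePair (Torus.geometry (Fin 3)) i j (Φ.flow r z)) i j else 0) ≤ g z) ∧ ∀ P : Measure (Config n (Fin 3) T3), ∫⁻ z, g z ∂P ≤ Filter.liminf (fun M : ℕ => ∑ k ∈ Finset.range M, ∫⁻ w, ∑ i : Fin n, ∑ j : Fin n, (if i ≠ j then (E M i j).indicator (fun w => Ft M w i j) w else 0) ∂(P.map (Φ.flow ((k : ℝ) * (τ / M) + s)))) Filter.atTop := by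
  sorry

/-- **S3 · would-be pairs along a forward free flight; marks bounded by a velocity weight.** -/
theorem shareRung0_flightTransfer : ∀ {n : ℕ} (ε Δ t : ℝ) (w : Config n (Fin 3) T3) (e k : Fin n) (F₀ : T3 → T3 → V3 → V3 → ℝ) (m : V3 → V3 → ℝ), 0 < Δ → 0 ≤ t → (∀ x y v v', 0 ≤ F₀ x y v v') → (∀ x y v v', F₀ x y v v' ≤ m v v') → pairSum ε Δ (freeFlight (Torus.geometry (Fin 3)) t w) 0 (fun _ => F₀) ((wouldBePairs ε Δ (freeFlight (Torus.geometry (Fin 3)) t w)).filter fun p => (p.1 = e ∧ p.2 ≠ k) ∨ (p.2 = e ∧ p.1 ≠ k)) ≤ ∑ o : Fin n, (if o ≠ e ∧ o ≠ k then ((if (e, o) ∈ wouldBePairs ε (Δ + t) w then m (w e).2 (w o).2 else 0) + (if (o, e) ∈ wouldBePairs ε (Δ + t) w then m (w o).2 (w e).2 else 0)) else 0) := by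
  sorry

/-- **S4 · 3-label statics, weighted, two look-aheads: forward contact of `(e,k)` within `h₁` and `(e,o)` would-be within `h₂`.** -/
theorem shareRung0_statics : ∀ (σ : ℝ), 0 < σ → σ ≤ 1 / 2 → SmallDensity uniformProfile σ → ∀ (a θ : ℝ), 0 < a → 0 < θ → ∀ (u : V3), ∃ C : ℝ, 0 ≤ C ∧ ∀ (N : ℕ) (Φ : HardSphereFlow (Torus.geometry (Fin 3)) (hsDiameter σ N) (N + 1)) (h₁ h₂ : ℝ), 0 < h₁ → 0 < h₂ → ∃ Mw : Fin (N + 1) → Fin (N + 1) → Config (N + 1) (Fin 3) T3 → ℝ≥0∞, (∀ e k, Measurable (Mw e k)) ∧ (∀ w ∈ hardSphereDomain (Torus.geometry (Fin 3)) (N + 1) (hsDiameter σ N), ∀ e k : Fin (N + 1), e ≠ k → (∃ t ∈ Set.Icc 0 h₁, ‖(Torus.geometry (Fin 3)).sepVec ((freeFlight (Torus.geometry (Fin 3)) t w e).1) ((freeFlight (Torus.geometry (Fin 3)) t w k).1)‖ = hsDiameter σ N) → (∑ o : Fin (N + 1), (if o ≠ e ∧ o ≠ k then ((if (e, o) ∈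 wouldBePairs (hsDiameter σ N) h₂ w then ENNReal.ofReal ((‖(w e).2‖ ^ 2 + ‖(w o).2‖ ^ 2) ^ 2) else 0) + (if (o, e) ∈ wouldBePairs (hsDiameter σ N) h₂ w then ENNReal.ofReal ((‖(w o).2‖ ^ 2 + ‖(w e).2‖ ^ 2) ^ 2) else 0)) else 0)) ≤ Mw e k w) ∧ ∫⁻ w, (∑ e : Fin (N + 1), ∑ k : Fin (N + 1), if e ≠ k then Mw e k w else 0) ∂(localGibbsLaw σ (fun _ => a) (fun _ => u) (fun _ => θ) N Φ) ≤ ENNReal.ofReal (C * (((N + 1 : ℕ) : ℝ) ^ 3 * (hsDiameter σ N ^ 4 * (h₁ * h₂)))) := by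
  sorry

/-- **S5 · positivity of the Maxwellian mean of the sphere-integrated band mixing mark, general thresholds `K₀`, `K₁ > 0`, band `K₂ = 3|K₀| + 3`.** -/
theorem shareRung0_markPositive : ∀ (θ : ℝ) (u : V3) (K₀ K₁ : ℝ), 0 < θ → 0 < K₁ → 0 < ∫ p : V3 × V3, sphereMark (fun q : V3 × V3 × V3 => if K₀ < ‖q.2.1‖ ∧ ‖q.2.1‖ ≤ 3 * |K₀| + 3 ∧ ‖q.2.2‖ ≤ K₁ then 2 * (‖(reflectVel q.1 (q.2.1, q.2.2)).1‖ ^ 2 * ‖(reflectVel q.1 (q.2.1, q.2.2)).2‖ ^ 2) else 0) p.1 p.2 * (localMaxwellian 1 θ u p.1 * localMaxwellian 1 θ u p.2) := by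
  sorry

/-- **S6 · the static first-partner floor up to the out-degree-≥-2 excess, general thresholds, explicit look-ahead `Δ = κ ε_N`.** -/
theorem shareRung0_floorWindow : ∀ (σ : ℝ), 0 < σ → SmallDensity uniformProfile σ → ∀ (a θb : ℝ), 0 < a → 0 < θb → ∀ (u : V3) (N : ℕ) (Φ : HardSphereFlow (Torus.geometry (Fin 3)) (hsDiameter σ N) (N + 1)) (r K₀ K₁ K₂ κ Δ : ℝ), 0 ≤ K₁ → 0 ≤ K₂ → 0 < κ → κ * hsDiameter σ N = Δ → hsDiameter σ N * (1 + 2 * κ * (K₁ + K₂ + 1)) < 1 / 2 → ENNReal.ofReal (((N + 1 : ℕ) : ℝ) * N * ((1 - 16 * ovDensity uniformProfile σ) * hsDiameter σ N ^ 3 * κ * ∫ p : V3 × V3, sphereMark (fun q : V3 × V3 × V3 => if K₀ < ‖q.2.1‖ ∧ ‖q.2.1‖ ≤ K₂ ∧ ‖q.2.2‖ ≤ K₁ then 2 * (‖(reflectVel q.1 (q.2.1, q.2.2)).1‖ ^ 2 * ‖(reflectVel q.1 (q.2.1, q.2.2)).2‖ ^ 2) else 0) p.1 p.2 * (localMaxwellian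 1 θb u p.1 * localMaxwellian 1 θb u p.2))) ≤ ((N + 1 : ℕ) : ℝ≥0∞) * (∫⁻ z, ENNReal.ofReal (firstPartnerSum (hsDiameter σ N) Δ (Φ.flow r z) r (mixMark N K₀ K₁)) ∂(localGibbsLaw σ (fun _ => a) (fun _ => u) (fun _ => θb) N Φ)) + ENNReal.ofReal ((K₂ ^ 2 + K₁ ^ 2) ^ 2 / 2 * (4096 * (((N + 1 : ℕ) : ℝ) ^ 3 * (hsDiameter σ N ^ 4 * (κ * hsDiameter σ N) ^ 2 * (‖u‖ ^ 2 + 3 * θb))))) := by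
  sorry

/-- **Target · RUNG 0 of I′ `FirstPartnerRealisedShare`: constant profiles, every flow family, all thresholds, `A = 2`.** -/
theorem stub_firstPartnerRealisedShareRung0 : ∀ (a θb : ℝ) (u : V3), 0 < a → 0 < θb → ∃ σ₀ : ℝ, 0 < σ₀ ∧ ∀ σ : ℝ, 0 < σ → σ < σ₀ → ∀ T : ℝ, 0 < T → ∀ Φ : ((N : ℕ) → HardSphereFlow (Torus.geometry (Fin 3)) (hsDiameter σ N) (N + 1)), ∀ K₀ K₁ : ℝ, ∃ τ₀ : ℝ, 0 < τ₀ ∧ ∃ A : ℝ, 1 ≤ A ∧ ∃ N₀ : ℕ, ∀ N : ℕ, N₀ ≤ N → ∀ Δ : ℝ, 0 < Δ → Δ ≤ τ₀ * ((N : ℝ) + 1) ^ (-(1 / 3 : ℝ)) → ∀ r : ℝ, 0 ≤ r → r + Δ ≤ T → (∫⁻ z, ENNReal.ofReal (firstPartnerSum (hsDiameter σ N) Δ ((Φ N).flow r z) r (mixMark N K₀ K₁)) ∂(localGibbsLaw σ (fun _ => a) (fun _ => u) (fun _ => θb) N (Φ N))) ≤ ENNReal.ofReal A * (∫⁻ z,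 ENNReal.ofReal (realisedFirstSum (hsDiameter σ N) Δ (fun t => (Φ N).flow t z) r (mixMark N K₀ K₁)) ∂(localGibbsLaw σ (fun _ => a) (fun _ => u) (fun _ => θb) N (Φ N))) := by
  sorry

/-- Sanity: the rung-0 target is LITERALLY I′ at constant profiles (so the certificate is an instance of the stub). -/
example (h : FirstPartnerRealisedShare) : type_of% stub_firstPartnerRealisedShareRung0 :=
  fun a θb u ha hθ => h (fun _ => a) (fun _ => θb) (fun _ => u) continuous_const continuous_const
    continuous_const (fun _ => ha) (fun _ => hθ)

end QuarticSchurLedger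

end Summit.AtomisticToContinuum.HydrodynamicLimit.Theorems

end
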